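import Summits.BirchSwinnertonDyer.BirchSwinnertonDyer.Theorems.ByReductionTypeAtTwoTwoTorsionIsogenyPairs
import Summits.BirchSwinnertonDyer.BirchSwinnertonDyer.Theorems.TwoAdicConverseTwoTorsionAtoms
import HarnessLib

/-!
# Route `ByReductionTypeAtTwo` (rung K4, the FORMULA axis at `2`), items 19095 / 19096, stratum (β): BSD₂ along
# `ℤ/2`-linked pairs at a good-ordinary OR multiplicative `2`, and the three ATOMS A₁ / A₂ / A₃ (proofs only)

Cell `bsd-2adic`, seat `bsd-2adic-conv-1` (GEN 20; S3 lineage, K4 twin `--supports stmt-BirchSwinnertonDyer-19095`).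
THEOREMS ONLY — no definition, no named fact, no `sorry`.  HONEST FRAMING: BSD is not proved by any of this; `BSD(E, 2)`
on stratum (β) is OPEN class-wide (K4's cruxes); GZK, Cassels' isogeny invariance and modularity are PRINT facts displayed
BY NAME; nothing is booked (D-0054).  PARTITION: X5@2 good-ord + mult, rows (β) «`E(ℚ)[2] ≠ 0`» × `p = 2` —
types-the-object-of; closes none.

conv-1 GEN 19 (`ByReductionTypeAtTwoTwoTorsionIsogenyPairs`, p627575) proved `BSD(W,2) ⟺ BSD(W',2)` on a pair with
`r_an ≤ 1` and shrank K4's (β) piece at a GOOD ORDINARY `2` to the two Greenberg configurations (M)/(R).  With the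
multiplicative transport of this GEN (`mult_two_iff_of_twoTorsionPair`, `goodOrd_or_mult_two_iff_of_twoTorsionPair`,
p629321) and the atoms (`atom_cases`, p630731) this file records, on the formula axis:
* §1 **(β) at a good-ordinary OR multiplicative `2`, `r_an ≤ 1`, ⇐ (M) ∧ (R)**
  (`semistable_twoTorsion_bsdp_le_one_of_mixed_of_ramifiedOdd`; 19096's multiplicative classes included);
* §2 **(β) ⇐ BSD₂ on the three ATOMS** A₁ «`Δ < 0` ∧ ramified, or unramified middle» / A₂ «`Δ < 0` ∧ unramified, or
  ramified middle» / A₃ «`Δ > 0` ∧ extreme» — a plain case split (`semistable_twoTorsion_bsdp_of_atoms`,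
  `goodOrd_twoTorsion_bsdp_rankZero_of_atoms`); the atoms are closed under the pair and under the admissible twists
  (`atom₁/₂/₃_twist`, p630697), which (M)/(R) are not (negative twists swap the types R₂ ↔ M₂ with both `Δ > 0`).

References: Greenberg LNM 1716 §5 [GreenbergLNM1716]; Milne ADT I.7.3 / Cassels VIII [MilneADT2006]; Silverman *AEC*
III.4.5, VII.7.2, §C.16 [SilvermanAEC2009].
-/

set_option linter.dupNamespace false  -- `BirchSwinnertonDyer.BirchSwinnertonDyer` is the sub's path (D-0017)
set_option autoImplicit false

noncomputable section

open scoped Classical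
open WeierstrassCurve Literature Literature.NumberTheory.EllipticCurves
  Literature.NumberTheory.EllipticCurves.Rank1Residual
  Literature.NumberTheory.EllipticCurves.Rank1Residual.Typed
  Literature.NumberTheory.EllipticCurves.Greenberg1999

namespace Summit.BirchSwinnertonDyer.BirchSwinnertonDyer.Theorems.TwoAdicOffHabitat

/-! ## §1 (β) at a good-ordinary OR multiplicative `2` from (M) and (R), formula axis -/

/-- **BSD₂ on stratum (β) of the semistable-at-`2` domain, analytic rank `≤ 1`, from the two configurations** (modulo
PRINT {GZK, Cassels, modularity}): a «neither» point is traded for the partner's Prop-5.13 point; reduction type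
(`goodOrd_or_mult_two_iff_of_twoTorsionPair`), CM and `r_an` pass along the pair and BSD₂ transports
(`bsdp_two_iff_of_twoTorsionPair`). [cite: GreenbergLNM1716, Props. 5.13–5.14 (chunks p0168–p0170)] [cite: MilneADT2006, Thm. I.7.3] -/
theorem semistable_twoTorsion_bsdp_le_one_of_mixed_of_ramifiedOdd (hGZK : rank_eq_analyticRank_of_analyticRank_le_one)
    (hCassels : bsdRHS_eq_of_isIsogenous) (hmod : hasEntireLFunction_rat)
    (hM : ∀ (V : WeierstrassCurve ℚ) [V.IsElliptic] [V.IsGloballyMinimal], ¬ V.HasCM → V.analyticRank ≤ 1 →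
      (GoodOrd V 2 ∨ Mult V 2) → (∃ x : ℚ, HasRationalTwoTorsionX V x ∧
        ((TwoTorsionRamifiedAtTwo x ∧ ¬ TwoTorsionOdd V x) ∨ (TwoTorsionOdd V x ∧ ¬ TwoTorsionRamifiedAtTwo x))) →
      BSDp V 2)
    (hR : ∀ (V : WeierstrassCurve ℚ) [V.IsElliptic] [V.IsGloballyMinimal], ¬ V.HasCM → V.analyticRank ≤ 1 →
      (GoodOrd V 2 ∨ Mult V 2) →
      (∃ x : ℚ, HasRationalTwoTorsionX V x ∧ TwoTorsionRamifiedAtTwo x ∧ TwoTorsionOdd V x) → BSDp V 2) :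
    ∀ (V : WeierstrassCurve ℚ) [V.IsElliptic] [V.IsGloballyMinimal], ¬ V.HasCM → V.analyticRank ≤ 1 →
      (GoodOrd V 2 ∨ Mult V 2) → (∃ P : V.toAffine.Point, P ≠ 0 ∧ 2 • P = 0) → BSDp V 2 := by
  intro W _ _ hCM hr hred hP
  obtain ⟨x₀, y₀, hEq, h2⟩ := (exists_two_torsion_iff_exists_hasRationalTwoTorsionX W).mp hP
  by_cases hmix : (TwoTorsionRamifiedAtTwo x₀ ∧ ¬ TwoTorsionOdd W x₀) ∨
      (TwoTorsionOdd W x₀ ∧ ¬ TwoTorsionRamifiedAtTwo x₀)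
  · exact hM W hCM hr hred ⟨x₀, ⟨y₀, hEq, h2⟩, hmix⟩
  by_cases hRO : TwoTorsionRamifiedAtTwo x₀ ∧ TwoTorsionOdd W x₀
  · exact hR W hCM hr hred ⟨x₀, ⟨y₀, hEq, h2⟩, hRO⟩
  have hN : ¬ TwoTorsionRamifiedAtTwo x₀ ∧ ¬ TwoTorsionOdd W x₀ := by tauto
  set C : VariableChange ℚ := ⟨1, x₀, -W.a₁ / 2, y₀⟩ with hC
  have hns : W.toAffine.Nonsingular x₀ y₀ := (WeierstrassCurve.Affine.equation_iff_nonsingular).mp hEq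
  have hy₀ : y₀ = W.toAffine.negY x₀ y₀ := by
    rw [WeierstrassCurve.Affine.negY]; linear_combination h2
  haveI hNF : (C • W).IsTwoTorsionNF := isTwoTorsionNF_smul_of_two_nsmul_eq_zero two_ne_zero hns hy₀
  obtain ⟨C₀, hmin⟩ := hasGlobalMinimalModel_rat_holds (C • W).twoIsogenyCodomain
  set W' : WeierstrassCurve ℚ := C₀ • (C • W).twoIsogenyCodomain with hW'
  haveI : W'.IsGloballyMinimal := hmin
  have hlink : C₀⁻¹ • W' = (C • W).twoIsogenyCodomain := inv_smul_smul C₀ _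
  haveI : (C₀⁻¹ • W').IsTwoTorsionNF := by rw [hlink]; infer_instance
  have hCr : C.r = x₀ := rfl
  have hred' : GoodOrd W' 2 ∨ Mult W' 2 := (goodOrd_or_mult_two_iff_of_twoTorsionPair hlink).mp hred
  have hCM' : ¬ W'.HasCM := fun h ↦ hCM ((hasCM_iff_of_twoTorsionPair hlink).mpr h)
  have hr' : W'.analyticRank ≤ 1 := (analyticRank_eq_of_twoTorsionPair hlink) ▸ hr
  have ha₁ := odd_a₁_integralModelInt_of_goodOrd_or_mult W hred
  have ha₁' := odd_a₁_integralModelInt_of_goodOrd_or_mult W' hred'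
  have hRO' : TwoTorsionRamifiedAtTwo C₀⁻¹.r ∧ TwoTorsionOdd W' C₀⁻¹.r :=
    (neither_iff_ramified_and_odd_of_twoIsogeny W W' C C₀⁻¹ ha₁ ha₁' hlink).mp (hCr ▸ hN)
  have hx' : HasRationalTwoTorsionX W' C₀⁻¹.r := hasRationalTwoTorsionX_of_isTwoTorsionNF_smul W' C₀⁻¹
  have h' : BSDp W' 2 := hR W' hCM' hr' hred' ⟨C₀⁻¹.r, hx', hRO'⟩
  exact (bsdp_two_iff_of_twoTorsionPair hGZK hCassels hmod hlink hr).mpr h'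

/-! ## §2 (β) from the three atoms, formula axis -/

/-- **BSD₂ on stratum (β) of the semistable-at-`2` domain, `r_an ≤ 1`, from BSD₂ on the three ATOMS** (a plain case
split by `atom_cases`; unconditional bookkeeping). [cite: GreenbergLNM1716, §5 Remarks (chunks p0170, p0174)] -/
theorem semistable_twoTorsion_bsdp_of_atoms
    (h₁ : ∀ (V : WeierstrassCurve ℚ) [V.IsElliptic] [V.IsGloballyMinimal], ¬ V.HasCM → V.analyticRank ≤ 1 →
      (GoodOrd V 2 ∨ Mult V 2) →
      (∃ x : ℚ, HasRationalTwoTorsionX V x ∧ ((V.Δ < 0 ∧ TwoTorsionRamifiedAtTwo x) ∨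
        (¬ TwoTorsionRamifiedAtTwo x ∧ ¬ TwoTorsionOdd V x ∧
          ¬ ∀ r : ℝ, 4 * r ^ 3 + (V.b₂ : ℝ) * r ^ 2 + 2 * (V.b₄ : ℝ) * r + (V.b₆ : ℝ) = 0 → r ≤ (x : ℝ)))) →
      BSDp V 2)
    (h₂ : ∀ (V : WeierstrassCurve ℚ) [V.IsElliptic] [V.IsGloballyMinimal], ¬ V.HasCM → V.analyticRank ≤ 1 →
      (GoodOrd V 2 ∨ Mult V 2) →
      (∃ x : ℚ, HasRationalTwoTorsionX V x ∧ ((V.Δ < 0 ∧ ¬ TwoTorsionRamifiedAtTwo x) ∨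
        (TwoTorsionRamifiedAtTwo x ∧ ¬ TwoTorsionOdd V x ∧
          ¬ ∀ r : ℝ, 4 * r ^ 3 + (V.b₂ : ℝ) * r ^ 2 + 2 * (V.b₄ : ℝ) * r + (V.b₆ : ℝ) = 0 → r ≤ (x : ℝ)))) →
      BSDp V 2)
    (h₃ : ∀ (V : WeierstrassCurve ℚ) [V.IsElliptic] [V.IsGloballyMinimal], ¬ V.HasCM → V.analyticRank ≤ 1 →
      (GoodOrd V 2 ∨ Mult V 2) →
      (∃ x : ℚ, HasRationalTwoTorsionX V x ∧ 0 < V.Δ ∧ (TwoTorsionOdd V x ∨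
          ∀ r : ℝ, 4 * r ^ 3 + (V.b₂ : ℝ) * r ^ 2 + 2 * (V.b₄ : ℝ) * r + (V.b₆ : ℝ) = 0 → r ≤ (x : ℝ))) →
      BSDp V 2) :
    ∀ (V : WeierstrassCurve ℚ) [V.IsElliptic] [V.IsGloballyMinimal], ¬ V.HasCM → V.analyticRank ≤ 1 →
      (GoodOrd V 2 ∨ Mult V 2) → (∃ P : V.toAffine.Point, P ≠ 0 ∧ 2 • P = 0) → BSDp V 2 := by
  intro W _ _ hCM hr hred hP
  obtain ⟨x₀, y₀, hEq, h2⟩ := (exists_two_torsion_iff_exists_hasRationalTwoTorsionX W).mp hP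
  have hx : HasRationalTwoTorsionX W x₀ := ⟨y₀, hEq, h2⟩
  rcases atom_cases W x₀ with h | h | h
  · exact h₁ W hCM hr hred ⟨x₀, hx, h⟩
  · exact h₂ W hCM hr hred ⟨x₀, hx, h⟩
  · exact h₃ W hCM hr hred ⟨x₀, hx, h⟩

/-- **Item 19095's (β) piece (good ordinary, `r_an = 0`) from BSD₂ on the three atoms** (case split).
[cite: GreenbergLNM1716, §5 Remarks (chunks p0170, p0174)] -/
theorem goodOrd_twoTorsion_bsdp_rankZero_of_atoms
    (h₁ : ∀ (V : WeierstrassCurve ℚ) [V.IsElliptic] [V.IsGloballyMinimal], ¬ V.HasCM → V.analyticRank = 0 →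
      GoodOrd V 2 →
      (∃ x : ℚ, HasRationalTwoTorsionX V x ∧ ((V.Δ < 0 ∧ TwoTorsionRamifiedAtTwo x) ∨
        (¬ TwoTorsionRamifiedAtTwo x ∧ ¬ TwoTorsionOdd V x ∧
          ¬ ∀ r : ℝ, 4 * r ^ 3 + (V.b₂ : ℝ) * r ^ 2 + 2 * (V.b₄ : ℝ) * r + (V.b₆ : ℝ) = 0 → r ≤ (x : ℝ)))) →
      BSDp V 2)
    (h₂ : ∀ (V : WeierstrassCurve ℚ) [V.IsElliptic] [V.IsGloballyMinimal], ¬ V.HasCM → V.analyticRank = 0 →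
      GoodOrd V 2 →
      (∃ x : ℚ, HasRationalTwoTorsionX V x ∧ ((V.Δ < 0 ∧ ¬ TwoTorsionRamifiedAtTwo x) ∨
        (TwoTorsionRamifiedAtTwo x ∧ ¬ TwoTorsionOdd V x ∧
          ¬ ∀ r : ℝ, 4 * r ^ 3 + (V.b₂ : ℝ) * r ^ 2 + 2 * (V.b₄ : ℝ) * r + (V.b₆ : ℝ) = 0 → r ≤ (x : ℝ)))) →
      BSDp V 2)
    (h₃ : ∀ (V : WeierstrassCurve ℚ) [V.IsElliptic] [V.IsGloballyMinimal], ¬ V.HasCM → V.analyticRank = 0 →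
      GoodOrd V 2 →
      (∃ x : ℚ, HasRationalTwoTorsionX V x ∧ 0 < V.Δ ∧ (TwoTorsionOdd V x ∨
          ∀ r : ℝ, 4 * r ^ 3 + (V.b₂ : ℝ) * r ^ 2 + 2 * (V.b₄ : ℝ) * r + (V.b₆ : ℝ) = 0 → r ≤ (x : ℝ))) →
      BSDp V 2) :
    ∀ (V : WeierstrassCurve ℚ) [V.IsElliptic] [V.IsGloballyMinimal], ¬ V.HasCM → V.analyticRank = 0 →
      GoodOrd V 2 → (∃ P : V.toAffine.Point, P ≠ 0 ∧ 2 • P = 0) → BSDp V 2 := by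
  intro W _ _ hCM hr hgo hP
  obtain ⟨x₀, y₀, hEq, h2⟩ := (exists_two_torsion_iff_exists_hasRationalTwoTorsionX W).mp hP
  have hx : HasRationalTwoTorsionX W x₀ := ⟨y₀, hEq, h2⟩
  rcases atom_cases W x₀ with h | h | h
  · exact h₁ W hCM hr hgo ⟨x₀, hx, h⟩
  · exact h₂ W hCM hr hgo ⟨x₀, hx, h⟩
  · exact h₃ W hCM hr hgo ⟨x₀, hx, h⟩

end Summit.BirchSwinnertonDyer.BirchSwinnertonDyer.Theorems.TwoAdicOffHabitat

end
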